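import Summits.QuantumAdvantage.QuantumAdvantage.Theorems.CubicForrelationNearExactIsExactFourteenDigits
import Summits.QuantumAdvantage.QuantumAdvantage.Theorems.CubicForrelationNearExactIsExactFourteenQuarterFlat
import Summits.QuantumAdvantage.QuantumAdvantage.Theorems.CubicForrelationNearExactIsExactFlatSumsGeneral
import Summits.QuantumAdvantage.QuantumAdvantage.Theorems.CubicForrelationNearExactIsExactEightTypeE
import Summits.QuantumAdvantage.QuantumAdvantage.Theorems.CubicForrelationNearExactIsExactIsolationSmallN
import Summits.QuantumAdvantage.QuantumAdvantage.Theorems.CubicForrelationNearExactIsExactTenZCount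
import Summits.QuantumAdvantage.QuantumAdvantage.Theorems.CubicForrelationNearExactIsExactEightSymplectic

/-!
# Crux `CubicForrelation.NearExactIsExact` (stmt-QuantumAdvantage-14043) — n = 14 two-sided analysis: budgets, cosets, `±`characters
  (preparatory lemmas for `…FourteenLevelSix.lean`)

Certificate seat `b2b-cforr-cert` (gen 4).  HONEST FRAMING: elementary lemmas feeding a theorem about cubic Boolean functions on 14 bits
(the finite slice `n = 14` of the crux) — NOT summit progress.

* `fl_parseval14`, `fl_budget5`, `fl_budget6`: Parseval `Σ W_g² = 2²⁸` on 14 bits and the TWO-SIDED budgets `Σ_x (u − 4(−1)^f)² = 2¹⁹(1 − Φ)`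
  (`W_g = 32u`, Ax base) and `Σ_x (u' − 2(−1)^f)² = 2¹⁷(1 − Φ)` (`W_g = 64u'`, level 6).
* `fl_coset_translate`, `fl_char_coset` (general `n`; the landed `tep_parity_translate` / `tep_char_coset` are 8-bit instances): translates
  of a coset `x₀ ⊕ V₀`, and twisted coset sums of a multiplicative `±1` function on a coset are `0` or `±|V₀|`.
* `fl_abs_sum_le`: a transform with values in `{0, ±K}` pairs with a function bounded by `1` to at most `Σ T²/K`.
* `fl_dirs14`: two directions transversal to a set of size `≤ 8191` on 14 bits; `fl_pt_four` (general `n`): the points of a parametrised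
  4-flat as iterated `⊕`; `fl_signs_of_four_dvd`: four signs with sum `≡ 0 (mod 4)` multiply consistently.

References: S. Aaronson, A. Ambainis, SIAM J. Comput. 47 (2018) §1.1.1; R. O'Donnell, *Analysis of Boolean Functions* (2014) §3.3.
Everything below is proved from Mathlib and the tree; axioms are the standard three.
-/

set_option linter.dupNamespace false -- D-0017: single-problem summit ⇒ `QuantumAdvantage.QuantumAdvantage` by design

noncomputable section

namespace Summit.QuantumAdvantage.QuantumAdvantage.Theorems.CubicForrelation.NearExactIsExact

open Finset
open Literature.Computability.QuantumComplexity
open Literature.Computability.QuantumComplexity.BuzetChailloux (bxor zeroVec bxor_bxor_cancel_left bxor_zeroVec zeroVec_bxor bxor_comm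
  signOf_sq)
open Literature.Computability.QuantumComplexity.DerivativeWalsh (W sum_W_sq twist_bxor_left sum_char_subspace)

variable {n : ℕ}

/-! ### Parseval and the two-sided budgets on 14 bits -/

/-- Parseval on 14 bits: `Σ_x W_g(x)² = 2²⁸`. [folklore] -/
theorem fl_parseval14 (g : (Fin (7 + 7) → Bool) → Bool) : ∑ x, W (fun y => signOf (g y)) x ^ 2 = (2 : ℝ) ^ 28 := by
  rw [sum_W_sq, sum_congr rfl fun y _ => signOf_sq (g y), sum_const, card_univ, Fintype.card_fun, Fintype.card_bool,
    Fintype.card_fin]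
  norm_num

/-- **Two-sided budget at the Ax base level on 14 bits.** With `W_g = 32u` and `s = (−1)^f`: `Σ_x (u − 4s)² = 2¹⁹·(1 − Φ(f,g))`.
[this work] -/
theorem fl_budget5 (f g : (Fin (7 + 7) → Bool) → Bool) (u : (Fin (7 + 7) → Bool) → ℤ)
    (hu : ∀ x, W (fun y => signOf (g y)) x = (2 : ℝ) ^ 5 * (u x : ℝ)) :
    ((∑ x, (u x - 4 * sZ (f x)) ^ 2 : ℤ) : ℝ) = (2 : ℝ) ^ 19 * (1 - forrelation f g) := by
  have hP := fl_parseval14 g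
  have hΦ := vg_two_pow_mul_forrelation f g
  have e : ∀ x : Fin (7 + 7) → Bool, ((u x : ℝ) - 4 * (sZ (f x) : ℝ)) ^ 2 =
      W (fun y => signOf (g y)) x ^ 2 / 1024 - signOf (f x) * W (fun y => signOf (g y)) x / 4 + 16 := by
    intro x
    have hux : (u x : ℝ) = W (fun y => signOf (g y)) x / 32 := by rw [hu x]; ring
    have hs2 : signOf (f x) ^ 2 = 1 := signOf_sq _
    rw [tp_sZ_cast, hux]
    nlinarith [hs2]
  push_cast
  rw [sum_congr rfl fun x _ => e x, sum_add_distrib, sum_sub_distrib, ← sum_div, ← sum_div, hP, ← hΦ, sum_const,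
    card_univ, Fintype.card_fun, Fintype.card_bool, Fintype.card_fin]
  norm_num
  ring

/-- **Two-sided budget at level 6 on 14 bits.** With `W_g = 64u'` and `s = (−1)^f`: `Σ_x (u' − 2s)² = 2¹⁷·(1 − Φ(f,g))`. [this work] -/
theorem fl_budget6 (f g : (Fin (7 + 7) → Bool) → Bool) (u' : (Fin (7 + 7) → Bool) → ℤ)
    (hu : ∀ x, W (fun y => signOf (g y)) x = (2 : ℝ) ^ 6 * (u' x : ℝ)) :
    ((∑ x, (u' x - 2 * sZ (f x)) ^ 2 : ℤ) : ℝ) = (2 : ℝ) ^ 17 * (1 - forrelation f g) := by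
  have hP := fl_parseval14 g
  have hΦ := vg_two_pow_mul_forrelation f g
  have e : ∀ x : Fin (7 + 7) → Bool, ((u' x : ℝ) - 2 * (sZ (f x) : ℝ)) ^ 2 =
      W (fun y => signOf (g y)) x ^ 2 / 4096 - signOf (f x) * W (fun y => signOf (g y)) x / 16 + 4 := by
    intro x
    have hux : (u' x : ℝ) = W (fun y => signOf (g y)) x / 64 := by rw [hu x]; ring
    have hs2 : signOf (f x) ^ 2 = 1 := signOf_sq _
    rw [tp_sZ_cast, hux]
    nlinarith [hs2]
  push_cast
  rw [sum_congr rfl fun x _ => e x, sum_add_distrib, sum_sub_distrib, ← sum_div, ← sum_div, hP, ← hΦ, sum_const,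
    card_univ, Fintype.card_fun, Fintype.card_bool, Fintype.card_fin]
  norm_num
  ring

/-! ### Coset bookkeeping, `±`characters, four frequencies (general `n`) -/

/-- **Translates of a coset.** If `S = x₀ ⊕ V₀` (`V₀` `⊕`-closed) then for `x ∈ S` and `c ∈ V₀`: `x ⊕ c ⊕ t ∈ S ↔ t ∈ V₀`. [folklore] -/
theorem fl_coset_translate (V₀ S : Finset (Fin n → Bool)) (x₀ : Fin n → Bool)
    (hadd : ∀ a ∈ V₀, ∀ b ∈ V₀, bxor a b ∈ V₀) (hS : S = V₀.image (bxor x₀))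
    {x c : Fin n → Bool} (hx : x ∈ S) (hc : c ∈ V₀) (t : Fin n → Bool) :
    bxor (bxor x c) t ∈ S ↔ t ∈ V₀ := by
  have hev : ∀ y, y ∈ S ↔ bxor x₀ y ∈ V₀ := by
    intro y
    rw [hS, mem_image]
    constructor
    · rintro ⟨a, ha, rfl⟩; rwa [bxor_bxor_cancel_left]
    · intro h; exact ⟨bxor x₀ y, h, bxor_bxor_cancel_left x₀ y⟩
  rw [hev]
  have hm : bxor x₀ x ∈ V₀ := (hev x).1 hx
  have hmc : bxor (bxor x₀ x) c ∈ V₀ := hadd _ hm _ hc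
  have e : bxor x₀ (bxor (bxor x c) t) = bxor (bxor (bxor x₀ x) c) t := by
    funext j; show (x₀ j ^^ ((x j ^^ c j) ^^ t j)) = (((x₀ j ^^ x j) ^^ c j) ^^ t j); simp only [Bool.xor_assoc]
  rw [e]
  constructor
  · intro h
    have := hadd _ hmc _ h
    rwa [bxor_bxor_cancel_left] at this
  · intro ht; exact hadd _ hmc _ ht

/-- **Twisted coset sums of a `±`character** (general `n`; the landed `tep_char_coset` is the 8-bit instance).  Let `V₀ ∋ 0` be
`⊕`-closed and `A` real with `A(x₀ ⊕ c) = ±1` for `c ∈ V₀`, multiplicative along `V₀`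
(`A(x₀ ⊕ c ⊕ c')·A(x₀) = A(x₀ ⊕ c)·A(x₀ ⊕ c')`).  Then every twisted coset sum `Σ_{c ∈ V₀} A(x₀ ⊕ c)(−1)^{(x₀⊕c)·y}` is `0` or `±|V₀|`.
[cite: ODonnell2014, §3.3] -/
theorem fl_char_coset (V₀ : Finset (Fin n → Bool)) (h0 : zeroVec ∈ V₀) (hadd : ∀ a ∈ V₀, ∀ b ∈ V₀, bxor a b ∈ V₀)
    (x₀ : Fin n → Bool) (A : (Fin n → Bool) → ℝ) (hA : ∀ c ∈ V₀, A (bxor x₀ c) = 1 ∨ A (bxor x₀ c) = -1)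
    (hmul : ∀ c ∈ V₀, ∀ c' ∈ V₀, A (bxor x₀ (bxor c c')) * A x₀ = A (bxor x₀ c) * A (bxor x₀ c')) (y : Fin n → Bool) :
    ∃ r : ℝ, (r = 0 ∨ r = 1 ∨ r = -1) ∧ ∑ c ∈ V₀, A (bxor x₀ c) * twist (bxor x₀ c) y = r * #V₀ := by
  have hA0 : A x₀ = 1 ∨ A x₀ = -1 := by simpa only [bxor_zeroVec] using hA zeroVec h0
  have hA0sq : A x₀ * A x₀ = 1 := by rcases hA0 with h | h <;> rw [h] <;> norm_num
  have hχ := sum_char_subspace hadd (fun c => A (bxor x₀ c) * A x₀ * twist c y)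
    (fun c hc => by
      rcases hA c hc with h | h <;> rcases hA0 with h' | h' <;> rcases Simon.twist_eq_one_or c y with h'' | h'' <;>
        simp only [h, h', h''] <;> norm_num)
    (fun c hc c' hc' => by
      show A (bxor x₀ (bxor c c')) * A x₀ * twist (bxor c c') y =
        A (bxor x₀ c) * A x₀ * twist c y * (A (bxor x₀ c') * A x₀ * twist c' y)
      rw [twist_bxor_left, hmul c hc c' hc']
      linear_combination (A (bxor x₀ c) * A (bxor x₀ c') * twist c y * twist c' y) * hA0sq.symm)
  have hre : ∑ c ∈ V₀, A (bxor x₀ c) * twist (bxor x₀ c) y =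
      A x₀ * twist x₀ y * ∑ c ∈ V₀, A (bxor x₀ c) * A x₀ * twist c y := by
    rw [mul_sum]
    refine sum_congr rfl fun c _ => ?_
    rw [twist_bxor_left]
    linear_combination (A (bxor x₀ c) * twist x₀ y * twist c y) * hA0sq.symm
  rw [hre]
  rcases hχ with h | h <;> rw [h]
  · refine ⟨A x₀ * twist x₀ y, ?_, by ring⟩
    rcases hA0 with h' | h' <;> rcases Simon.twist_eq_one_or x₀ y with h'' | h'' <;> simp [h', h'']
  · exact ⟨0, Or.inl rfl, by ring⟩

/-- **Few frequencies.** If a transform `T` takes values in `{0, ±K}` (`K > 0`), its pairing with any function bounded by `1` is at most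
`Σ T²/K` in absolute value. [folklore] -/
theorem fl_abs_sum_le (T σ : (Fin n → Bool) → ℝ) {K : ℝ} (hK : 0 < K) (hT : ∀ y, T y = 0 ∨ T y = K ∨ T y = -K)
    (hσ : ∀ y, |σ y| ≤ 1) : |∑ y, σ y * T y| ≤ (∑ y, T y ^ 2) / K := by
  have habs : ∀ y, |T y| = T y ^ 2 / K := by
    intro y
    rcases hT y with h | h | h <;> rw [h]
    · simp
    · rw [abs_of_pos hK]; field_simp
    · rw [abs_neg, abs_of_pos hK]; field_simp
  calc |∑ y, σ y * T y| ≤ ∑ y, |σ y * T y| := abs_sum_le_sum_abs _ _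
    _ ≤ ∑ y, |T y| := sum_le_sum fun y _ => by
        rw [abs_mul]
        calc |σ y| * |T y| ≤ 1 * |T y| := mul_le_mul_of_nonneg_right (hσ y) (abs_nonneg _)
          _ = |T y| := one_mul _
    _ = ∑ y, T y ^ 2 / K := sum_congr rfl fun y _ => habs y
    _ = (∑ y, T y ^ 2) / K := by rw [sum_div]

/-- Two transversal directions on 14 bits: if `|V₀| ≤ 8191` there are `d₁, d₂` with `d₁, d₂, d₁ ⊕ d₂ ∉ V₀`. [folklore] -/
theorem fl_dirs14 (V₀ : Finset (Fin (7 + 7) → Bool)) (hcard : #V₀ ≤ 8191) :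
    ∃ d₁ d₂ : Fin (7 + 7) → Bool, d₁ ∉ V₀ ∧ d₂ ∉ V₀ ∧ bxor d₁ d₂ ∉ V₀ := by
  classical
  have huniv : #(univ : Finset (Fin (7 + 7) → Bool)) = 16384 := by simp
  obtain ⟨d₁, -, hd₁⟩ : ∃ d₁ ∈ (univ : Finset (Fin (7 + 7) → Bool)), d₁ ∉ V₀ :=
    exists_mem_notMem_of_card_lt_card (by rw [huniv]; omega)
  have hS : #(V₀ ∪ V₀.image (bxor d₁)) < #(univ : Finset (Fin (7 + 7) → Bool)) := by
    rw [huniv]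
    calc #(V₀ ∪ V₀.image (bxor d₁)) ≤ #V₀ + #(V₀.image (bxor d₁)) := card_union_le _ _
      _ ≤ 8191 + 8191 := Nat.add_le_add hcard (card_image_le.trans hcard)
      _ < 16384 := by norm_num
  obtain ⟨d₂, -, hd₂⟩ := exists_mem_notMem_of_card_lt_card hS
  rw [mem_union, not_or] at hd₂
  refine ⟨d₁, d₂, hd₁, hd₂.1, fun h => hd₂.2 (mem_image.2 ⟨bxor d₁ d₂, h, bxor_bxor_cancel_left d₁ d₂⟩)⟩

/-- The points of the parametrised 4-flat `x ⊕ ⟨d₁,d₂,a,b⟩` as iterated `bxor`s: `x ⊕ ε₃b ⊕ ε₂a ⊕ ε₁d₂ ⊕ ε₀d₁` (general `n`; the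
landed `te_pt_four` is the 8-bit instance). [folklore] -/
theorem fl_pt_four (x d₁ d₂ a b : Fin n → Bool) (e₀ e₁ e₂ e₃ : Bool) (t : Fin 0 → Bool) (ta : Fin 0 → Fin n → Bool) :
    (fun j => x j ^^ decide (Odd #(univ.filter fun i : Fin 4 =>
      (Fin.cons e₀ (Fin.cons e₁ (Fin.cons e₂ (Fin.cons e₃ t : Fin 1 → Bool) : Fin 2 → Bool) : Fin 3 → Bool) : Fin 4 → Bool) i &&
      (Fin.cons d₁ (Fin.cons d₂ (Fin.cons a (Fin.cons b ta : Fin 1 → Fin n → Bool) : Fin 2 → Fin n → Bool)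
        : Fin 3 → Fin n → Bool) : Fin 4 → Fin n → Bool) i j))) =
      bxor (bxor (bxor (bxor x (fun j => e₃ && b j)) (fun j => e₂ && a j)) (fun j => e₁ && d₂ j)) (fun j => e₀ && d₁ j) := by
  have h1 := erm_flatPt_cons x d₁ (Fin.cons d₂ (Fin.cons a (Fin.cons b ta : Fin 1 → Fin n → Bool) : Fin 2 → Fin n → Bool)
      : Fin 3 → Fin n → Bool) e₀ (Fin.cons e₁ (Fin.cons e₂ (Fin.cons e₃ t : Fin 1 → Bool) : Fin 2 → Bool) : Fin 3 → Bool)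
  have h2 := erm_flatPt_cons x d₂ (Fin.cons a (Fin.cons b ta : Fin 1 → Fin n → Bool) : Fin 2 → Fin n → Bool) e₁
    (Fin.cons e₂ (Fin.cons e₃ t : Fin 1 → Bool) : Fin 2 → Bool)
  have h3 := erm_flatPt_cons x a (Fin.cons b ta : Fin 1 → Fin n → Bool) e₂ (Fin.cons e₃ t : Fin 1 → Bool)
  have h4 := erm_flatPt_cons x b ta e₃ t
  have h5 := tep_flatPt_nil x ta t
  rw [h1]
  funext j
  rw [congrFun h2 j, congrFun h3 j, congrFun h4 j, congrFun h5 j]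

/-- Four signs summing to a multiple of `4` multiply pairwise-consistently: `a·d = b·c`. [folklore] -/
theorem fl_signs_of_four_dvd {a b c d : ℤ} (ha : a = 1 ∨ a = -1) (hb : b = 1 ∨ b = -1) (hc : c = 1 ∨ c = -1)
    (hd : d = 1 ∨ d = -1) (h4 : (4 : ℤ) ∣ a + b + c + d) : d * a = b * c := by
  rcases ha with rfl | rfl <;> rcases hb with rfl | rfl <;> rcases hc with rfl | rfl <;> rcases hd with rfl | rfl <;>
    omega

end Summit.QuantumAdvantage.QuantumAdvantage.Theorems.CubicForrelation.NearExactIsExact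

end
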